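import Summits.Ventures.HodgeRepro.Night4KnownRegime
import Summits.Ventures.HodgeRepro.Night4ReducedDimTransport
import Summits.Ventures.HodgeRepro.CMTypeCount

/-!
# The exact open frontier of S4 as ONE kernel statement: `S0 ⇐ printed ∧ the cell's lemmas ∧ (S4 on the faces of degree ≥ 8)`

Blind re-derivation cell `pub-hodge-repro`, seat `night-4` (ROUTE HARDENING for the Monday FINAL, gen 2).  Target tree path
`lean/Summits/Ventures/HodgeRepro/Night4OpenFrontier.lean`.

ROUTE.md v2.88 / CHECKPOINT-Sun.md §1 read the open frontier of the deciding statement S4 as «the rank-four faces are the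
entire open frontier of S4» (Lemmas L / P, v2.39), with degree 6 CLOSED (§3.2: Lemma R + Markman Cor 1.6.1) and the
degree-8 / degree-12 faces OPEN (§3.3 / §3.4).  This file states that reading as one theorem over the abstract interface
`KnownRegimeData` (night-4 g0 / g1: `RouteChain`, `NightOpenInputs`, `Night4KnownRegime`, `Night4ReducedDimTransport`):

* `S0_of_open_frontier : AlgPull → S1 ∧ S2 ∧ S3 → LemmasLP → LemmaR_faces → ReducedFourfold_deg6 → Markman2025_Cor1_6_1 →
  (∀ d, 8 ≤ d → S4facesDeg d) → S0`

— every hypothesis a named `def … : Prop` already on the tree: PRINTED (`AlgPull`, `S1`, `S2`, `S3`, `Markman2025_Cor1_6_1`),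
UNPRINTED the cell's (`LemmasLP`, `LemmaR_faces`, `ReducedFourfold_deg6` — the §3.2 count, which gen 1's
`Night4ReducedDimRoute` reduces to the dictionary `DimReduced` alone, the count itself being kernel), OPEN (`S4facesDeg d`
for `d ≥ 8`).

What makes «`d ≥ 8`» exact is a KERNEL fact about the roster's faces (`TypeDatum.IsFace`: four corners with pairwise
distinct CM types, none the complex conjugate of another): the four corner types and their four conjugates are EIGHT
distinct CM types of `(G, c)`, and `(G, c)` has exactly `2^(|G|/2)` CM types (p1's `card_cmTypes`, `CMTypeCount.lean`), so
`|G| ≥ 6`; and `|G|` is even (`c` has order `2`).  Hence `S4facesDeg d` is VACUOUS for every `d ∉ {6, 8, 10, …}`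
(`S4facesDeg_of_card_lt_six`, `S4facesDeg_of_odd`), degree `6` is gen 1's `S4facesDeg6_of_Markman`, and the faces of the
Galois CM fields of degree `≥ 8` are exactly what is left.  Conversely `S4faces` is an instance of `S1 ∧ S4`
(gen 0's `S4faces_of_S1_S4`), so the frontier statement is not stronger than S4 itself.

NO open input is closed here; HC_CM is NOT proved.  Nothing in this file asserts anything about the original programme.
-/

open Finset
open scoped Pointwise

namespace HodgeRepro.Route

namespace TypeDatum

variable (D : TypeDatum)

/-- **A face needs at least six embeddings.**  For a face `Δ` of the roster (`IsFace`: `|Δ| = 4`, the corner types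
`φ_s` pairwise distinct, and no `φ_t` the conjugate `c • φ_s` of another), the sets `{φ_s : s ∈ Δ}` and
`{c • φ_s : s ∈ Δ}` are two disjoint four-element sets of CM types of `(G, c)`; since `(G, c)` has exactly
`2^(|G|/2)` CM types (`card_cmTypes`), `8 ≤ 2^(|G|/2)`, i.e. `|G| ≥ 6`. -/
theorem six_le_card_of_isFace {Δ : Finset D.S} (hΔ : D.IsFace Δ) : 6 ≤ Fintype.card D.G := by
  obtain ⟨hcard, -, hinj, hconj⟩ := hΔ
  -- the four corner types and their four conjugates
  set T : Finset (Finset D.G) := Δ.image D.liftedType with hT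
  set T' : Finset (Finset D.G) := T.image (fun Φ => D.c • Φ) with hT'
  have hTcard : T.card = 4 := by
    rw [hT, card_image_of_injOn hinj, hcard]
  have hsmul_inj : Function.Injective (fun Φ : Finset D.G => D.c • Φ) := by
    intro Φ Ψ h
    have h' : D.c • D.c • Φ = D.c • D.c • Ψ := by
      show D.c • (fun Φ : Finset D.G => D.c • Φ) Φ = D.c • (fun Φ : Finset D.G => D.c • Φ) Ψ
      rw [h]
    rwa [D.hc.smul_smul_finset, D.hc.smul_smul_finset] at h'
  have hT'card : T'.card = 4 := by
    rw [hT', card_image_of_injective _ hsmul_inj, hTcard]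
  -- they are disjoint: no corner type is the conjugate of another
  have hdisj : Disjoint T T' := by
    rw [disjoint_left]
    intro Φ hΦT hΦT'
    rw [hT, mem_image] at hΦT
    rw [hT', mem_image] at hΦT'
    obtain ⟨t, ht, rfl⟩ := hΦT
    obtain ⟨Ψ, hΨ, hΨeq⟩ := hΦT'
    rw [hT, mem_image] at hΨ
    obtain ⟨s, hs, rfl⟩ := hΨ
    exact hconj s hs t ht hΨeq.symm
  -- all eight are CM types
  have hsub : T ∪ T' ⊆ cmTypes D.c := by
    intro Φ hΦ
    rw [mem_cmTypes]
    rcases mem_union.mp hΦ with h | h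
    · rw [hT, mem_image] at h
      obtain ⟨s, -, rfl⟩ := h
      exact D.liftedType_isCMType s
    · rw [hT', mem_image] at h
      obtain ⟨Ψ, hΨ, rfl⟩ := h
      rw [hT, mem_image] at hΨ
      obtain ⟨s, -, rfl⟩ := hΨ
      exact IsCMType.conj D.hc (D.liftedType_isCMType s)
  have h8 : 8 ≤ (cmTypes D.c).card := by
    have := card_le_card hsub
    rw [card_union_of_disjoint hdisj, hTcard, hT'card] at this
    exact this
  rw [card_cmTypes D.hc] at h8
  -- `8 ≤ 2^(|G|/2)` forces `3 ≤ |G|/2`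
  have h3 : 3 ≤ Fintype.card D.G / 2 := by
    by_contra hlt
    have : 2 ^ (Fintype.card D.G / 2) ≤ 2 ^ 2 := Nat.pow_le_pow_right (by norm_num) (by omega)
    omega
  omega

/-- **The degree of a Galois CM field is even**: complex conjugation `c` has order `2`, which divides `|G|`. -/
theorem even_card : Even (Fintype.card D.G) := by
  have h2 : orderOf D.c = 2 := night4_orderOf_eq_two D.hc
  have hdvd : orderOf D.c ∣ Fintype.card D.G := orderOf_dvd_card
  rw [h2] at hdvd
  exact even_iff_two_dvd.mpr hdvd

end TypeDatum

section Frontier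

variable (𝓗 : RouteData)

/-- **`S4facesDeg d` is vacuous for `d < 6`**: a face needs `|G| ≥ 6` (`TypeDatum.six_le_card_of_isFace`). -/
theorem S4facesDeg_of_card_lt_six (d : ℕ) (hd : d < 6) : S4facesDeg 𝓗 d := by
  intro A _ hG Δ hΔ
  have h6 := (𝓗.typeOf A).six_le_card_of_isFace hΔ
  rw [hG] at h6
  omega

/-- **`S4facesDeg d` is vacuous for odd `d`**: `|G|` is even (`TypeDatum.even_card`). -/
theorem S4facesDeg_of_odd (d : ℕ) (hd : Odd d) : S4facesDeg 𝓗 d := by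
  intro A _ hG Δ hΔ
  have he := (𝓗.typeOf A).even_card
  rw [hG] at he
  exact absurd he (Nat.not_even_iff_odd.mpr hd)

/-- `S4faces` is the conjunction of its degree slices. -/
theorem S4faces_of_forall_deg (h : ∀ d : ℕ, S4facesDeg 𝓗 d) : S4faces 𝓗 :=
  fun A hA Δ hΔ => h _ A hA rfl Δ hΔ

/-- **`S4faces` is equivalent to the conjunction of its degree slices** (with gen 0's `S4facesDeg_of_S4faces`). -/
theorem S4faces_iff_forall_deg : S4faces 𝓗 ↔ ∀ d : ℕ, S4facesDeg 𝓗 d :=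
  ⟨S4facesDeg_of_S4faces 𝓗, S4faces_of_forall_deg 𝓗⟩

end Frontier

variable (𝓚 : KnownRegimeData)

/-- **The open frontier of `S4faces`**: given pull-back functoriality, the cell's Lemma R (`LemmaR_faces`), the §3.2
count `ReducedFourfold_deg6` (B_red an abelian fourfold in degree 6; = the dictionary `DimReduced` by gen 1's
`Night4ReducedDimRoute`, the count being kernel) and Markman's Corollary 1.6.1 (abelian fourfolds), `S4faces` follows
from S4 on the faces of the Galois CM fields of degree `≥ 8` alone — degree `6` is gen 1's `S4facesDeg6_of_Markman`,
and every other degree is vacuous (`S4facesDeg_of_card_lt_six`, `S4facesDeg_of_odd`). -/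
theorem S4faces_of_open_frontier (hpull : AlgPull 𝓚.toRouteData) (hR : LemmaR_faces 𝓚) (h6 : ReducedFourfold_deg6 𝓚)
    (hM : Markman2025_Cor1_6_1 𝓚) (hopen : ∀ d : ℕ, 8 ≤ d → S4facesDeg 𝓚.toRouteData d) :
    S4faces 𝓚.toRouteData := by
  apply S4faces_of_forall_deg
  intro d
  by_cases hd6 : d = 6
  · subst hd6
    exact S4facesDeg6_of_Markman 𝓚 hpull hR h6 hM
  · rcases Nat.lt_or_ge d 6 with hlt | hge
    · exact S4facesDeg_of_card_lt_six _ d hlt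
    · rcases Nat.even_or_odd d with he | ho
      · obtain ⟨r, hr⟩ := he
        exact hopen d (by omega)
      · exact S4facesDeg_of_odd _ d ho

/-- **THE EXACT OPEN FRONTIER — ROUTE.md §1–§3 as one statement.**  `S0` (HC for CM abelian varieties) follows from
PRINTED inputs — `AlgPull` (André 1996 Thm 0.3 (ii)), `S1` (Deligne §5 / Milne Thm 1 proof), `S2` (Pohlmann), `S3`
(André 1992 / Milne 2020 Thm 1), `Markman2025_Cor1_6_1` (abelian fourfolds) —, the cell's UNPRINTED lemmas — `LemmasLP`
(S4-faces ⟹ S4), `LemmaR_faces` (S3ᴿ), `ReducedFourfold_deg6` (the §3.2 count) —, and the OPEN statement `S4facesDeg d` for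
the Galois CM fields of degree `d ≥ 8` (ROUTE.md §3.3 / §3.4 and beyond).  Kernel-checked composition; nothing constructed;
no open input closed. -/
theorem S0_of_open_frontier (hpull : AlgPull 𝓚.toRouteData)
    (h : S1 𝓚.toRouteData ∧ S2 𝓚.toRouteData ∧ S3 𝓚.toRouteData) (hLP : LemmasLP 𝓚.toRouteData)
    (hR : LemmaR_faces 𝓚) (h6 : ReducedFourfold_deg6 𝓚) (hM : Markman2025_Cor1_6_1 𝓚)
    (hopen : ∀ d : ℕ, 8 ≤ d → S4facesDeg 𝓚.toRouteData d) : S0 𝓚.toRouteData :=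
  S0_of_chain_faces 𝓚.toRouteData hpull h (S4faces_of_open_frontier 𝓚 hpull hR h6 hM hopen) hLP

/-- The same with `S3` given in its precise printed form `S3precise` (Milne 2020 p0005:L67–74) and descent
(`S3_of_S2_S3precise`). -/
theorem S0_of_open_frontier_precise (hpull : AlgPull 𝓚.toRouteData)
    (h1 : S1 𝓚.toRouteData) (h2 : S2 𝓚.toRouteData) (h3 : S3precise 𝓚.toRouteData) (hLP : LemmasLP 𝓚.toRouteData)
    (hR : LemmaR_faces 𝓚) (h6 : ReducedFourfold_deg6 𝓚) (hM : Markman2025_Cor1_6_1 𝓚)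
    (hopen : ∀ d : ℕ, 8 ≤ d → S4facesDeg 𝓚.toRouteData d) : S0 𝓚.toRouteData :=
  S0_of_open_frontier 𝓚 hpull ⟨h1, h2, S3_of_S2_S3precise 𝓚.toRouteData h2 h3⟩ hLP hR h6 hM hopen

end HodgeRepro.Route
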